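import Summits.BirchSwinnertonDyer.BirchSwinnertonDyer.Theses.KolyvaginRankRigidityAtTwo
import Summits.BirchSwinnertonDyer.BirchSwinnertonDyer.Theorems.Rank1ResidualJetRingClassFields
import Summits.BirchSwinnertonDyer.BirchSwinnertonDyer.Theorems.ByReductionTypeAtTwoRankOneAtTwoOffBigImageOddLocalEngineEndToEnd
import Literature.NumberTheory.EllipticCurves.Jetchev2008.CoreVertices
import Summits.BirchSwinnertonDyer.BirchSwinnertonDyer.Theorems.KolyvaginRankRigidityAtTwoRegularCoreSupplyAtTwoRegularConductors
import Summits.BirchSwinnertonDyer.BirchSwinnertonDyer.Theorems.KolyvaginRankRigidityAtTwoWalkNearCore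
import HarnessLib

/-!
# LINE 17 `regular_core_rigidity` — crux U1 `KolyvaginBoundedDefectAtTwo` (stmt-BirchSwinnertonDyer-28083)
# of route `KolyvaginRankRigidityAtTwo` (KRR), ideator seat `bsd-idea-1` (D-0145, gen 9; technique card
# «compactness–contradiction / RIGIDITY»; director focus: beyond-print theorems at the prime 2).

TARGET BY NAME: `Summit.BirchSwinnertonDyer.BirchSwinnertonDyer.Theses.KolyvaginRankRigidityAtTwo.KolyvaginBoundedDefectAtTwo`
(U1 = the SEED HALF of V1′∞ `KolyvaginStrongNonzeroSystemAtTwo`; U2 `FullClassDeepeningAtTwo` is landed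
modulo Gross 1991 Prop. 3.7 (2), so U1 is what stands between the asided bare non-vanishing V1′ and KRR's
deciding input V1′∞). No summit, no rung and no crux is proved by this file; BSD is not proved.

IDEA (Mazur–Rubin CORE RIGIDITY transplanted to `p = 2` through REGULAR Kolyvagin primes). Mazur–Rubin
(PCMS 18 (2011) §2.4/§3.1, hypotheses (H.2)–(H.4); Cor. 2.8.9 (2), Thm. 3.2.3) and Howard (Compos. 140
(2004) Thm. 1, "assume p odd") prove: when the core rank is one, the module of Kolyvagin systems is FREE OF
RANK ONE, every generator is primitive, and at a CORE VERTEX `n` (modified Selmer group `H_{𝓕(n)}(K, E[p^M])`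
free of rank one over `ℤ/p^M`) restriction `KS → H_{𝓕(n)}` is an isomorphism. Consequence ("rigidity"): a
non-zero Kolyvagin system `κ = p^a · κ^prim` has `ord κ_n = p^{M−a}` at EVERY core vertex of EVERY level
`M > a` — the defect `a` is ONE global integer. That is exactly U1's shape (`m := a`), and it turns the
bare seed V1′ (one non-zero class somewhere) into bounded defect at all levels: the LEVEL-RAISING that
Kolyvagin's / Jetchev's walk (Prop. 5.3: only within the spare level `m(c) + m ≤ M(c)`) cannot do from a
seed of finite level, and that the LEAD's lossy swaps (S1L, loss `c₂` per swap) cannot do either.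
At `p = 2` two of MR's standing hypotheses fail as printed: (H.4) "`Ā ≇ Ā*` or `p ≥ 5`" (`E[2]` is
self-dual) and, at the primes Kolyvagin uses (Frobenius = complex conjugation `c₀ = diag(1,−1)` on
`E[2^M]`), (H.2) "`A/(τ−1)A` free of rank one": `E[2^M]/(c₀−1) ≅ ℤ/2^M ⊕ ℤ/2`. THE LEVER: at a REGULAR
prime `ℓ` (arithmetic Frobenius `h` an involution on `E[2^M]` with `2^{M−1}(1+h)E[2^M] ≠ 0`, i.e.
`h ~ c₀·[[0,1],[1,0]]`, `Frob_ℓ` non-trivial on `E[2]`) one has `E[2^M]/(h−1) ≅ (1+h)E[2^M] ≅ ℤ/2^M`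
— (H.2) HOLDS VERBATIM at 2 — and the finite/singular comparison `φ_ℓ^{fs}` is an isomorphism of free
rank-one `ℤ/2^M`-modules (lossless), so the Kolyvagin-system axioms and the core-vertex injectivity /
surjectivity arguments (MR Thm. 2.8.5, Howard's Thm. 2.8.8) have their rank-one local input at 2. Regular
Kolyvagin primes of every level, inert in `K`, with prescribed exact local orders of finitely many classes,
EXIST on this habitat (surjective `ρ_{E,2^m}`, odd `d_K`, Heegner hypothesis): the in-tree multi-class
Čebotarev engine `Theorems.OffBigImageOddLocalAtTwo.Engine.exists_regular_kolyvaginPrime_of_heegner`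
(stmt-23716 cell, sorry-free) — which is also what replaces MR's use of (H.4) (choosing Frobenius
conditions for `A` and `A*` simultaneously) in the p = 2 setting. The residual 2-specific obstruction is
(H.3): `H¹(ℚ(E[2^M])/ℚ, E[2^M]) ≅ ℤ/2` for surjective 2-adic image (Lawson–Wuthrich 2016) — a BOUNDED
phantom, absorbed into the defect `a` (this is where the line may die: see the card's falsifiers).
Since `τ = ±1` degenerates on 2-torsion (`H⁺ ∩ H⁻ ⊇ H[2]`, so Jetchev's `IsGlobalCoreVertex … 2 M c` is
unsatisfiable for `M ≥ 1`), the core notion at 2 is stated SIGN-FREE and with a UNIFORM ERROR `κ`: `H_{𝓕(n)}(K, E[2^M])`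
has a class of exact order `2^M` generating it up to `2^κ`-torsion (`IsNearCoreAt`, on the tree's parameter-free
`Jetchev2008.modifiedSelmerGroup`; `κ = 0` = cyclic of order `2^M`). The error room is forced: the (H.3) phantom is
INVISIBLE at regular primes (`H¹(⟨h⟩, E[2^M]) = 0`, toy-checked below by `decide` mod 4 and mod 8), so it can never
be cut away by adding regular primes; the defect `a = a(κ)` of S2 absorbs it.

SKELETON v3 (2026-08-28T21:4xZ, gen 10; v2 kept as `regular_core_rigidity.v2.lean`): registered stubs S0 (seed BY NAME), S1b
`stub_nearCoreExistenceAtTwo`, S2 `stub_coreRigidityAtTwo`; S1 `RegularCoreSupplyAtTwo` is DERIVED from S1b by krr2-p2's landed reduction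
(p668568); the predicates «regular prime at level 2^M» and «sign-free near-core vertex of error κ» are INLINED in every Prop (no local `def`),
so stub statements are landable byte-identically from `Theorems/`.  v2 layout for reference:
* S0 `stub_seedNonvanishingAtTwo : KolyvaginNonvanishingAtTwoFrame` — V1′ in frame form, BY NAME (the
  bare 2-adic Kolyvagin conjecture on the habitat; asided on the route as summit-adjacent, here it is the
  INPUT the line upgrades — the line's content is S1 + S2, i.e. "V1′ ⇒ U1").
* S1 `stub_regularCoreSupplyAtTwo : RegularCoreSupplyAtTwo` — sign-free near-core vertices (uniform error κ) of every level
  `M ≥ 1` and a fixed depth `r`, supported on regular Kolyvagin primes `> b` of index `≥ M`, carrying a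
  Kolyvagin–Heegner datum (MR Cor. 2.7.3 "core vertices n with ω(n) = r exist" at 2, fed by the engine).
* S2 `stub_coreRigidityAtTwo : CoreRigidityAtTwo` — THE HARDEST, beyond print: a seed forces a global
  defect `a = a(κ)` with `2^{M−a−1} · c_M(n) ≠ 0` at every regular near-core vertex `(n, M)` of error `κ`, `M > a`
  (MR Cor. 2.8.9 (2) + Thm. 3.2.3 + Howard Thm. 2.8.8 at p = 2 with (H.2) := regularity).
* `KolyvaginBoundedDefectAtTwo_of : S0 → S1 → S2 → KolyvaginBoundedDefectAtTwo` (r, κ from S1, m := a(κ)).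
-/

noncomputable section

namespace Summit.BirchSwinnertonDyer.BirchSwinnertonDyer.Cruxes.KolyvaginBoundedDefectAtTwo.RegularCoreRigidity

open scoped Classical Pointwise
open WeierstrassCurve NumberField IsDedekindDomain Field
open Literature.NumberTheory.GaloisRepresentations Literature.NumberTheory.EllipticCurves
open Literature.NumberTheory
open Rat.HeightOneSpectrum
open Summit.BirchSwinnertonDyer.BirchSwinnertonDyer.Theses.KolyvaginRankRigidityAtTwo

universe u

/-- TOY CHECK of the lever (in-Lean, `decide`): for the regular involution `h = [[0,1],[1,0]]` on `(ℤ/4)²`,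
`ker(1 + h) = im(h − 1)`, i.e. `H¹(⟨h⟩, E[4]) = 0` — every cocycle (in particular the (H.3) phantom) restricts to
ZERO on a regular Frobenius; contrast `c₀ = diag(1,−1)`, where `(2,0) ∈ ker(1 + c₀) ∖ im(c₀ − 1)`. [folklore] -/
theorem regularInvolution_h1_trivial_mod4 :
    ∀ a b : ZMod 4, a + b = 0 → ∃ c d : ZMod 4, d - c = a ∧ c - d = b := by
  decide

/-- The same at level `8`. [folklore] -/
theorem regularInvolution_h1_trivial_mod8 :
    ∀ a b : ZMod 8, a + b = 0 → ∃ c d : ZMod 8, d - c = a ∧ c - d = b := by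
  decide

/-- … whereas for the DIAGONAL complex conjugation `c₀ = diag(1,−1)` on `(ℤ/4)²`: `(2,0) ∈ ker(1 + c₀)`
(`2 + 2 = 0`, `0 − 0 = 0`) but `(2,0) ∉ im(c₀ − 1) = {(c − c, −d − d)}` — a non-trivial class in
`H¹(⟨c₀⟩, E[4])`: diagonal Kolyvagin primes DO see the phantom, regular ones never. [folklore] -/
theorem diagonalInvolution_h1_nontrivial_mod4 :
    ((2 : ZMod 4) + 2 = 0 ∧ (0 : ZMod 4) - 0 = 0) ∧ ¬ ∃ c d : ZMod 4, c - c = 2 ∧ -d - d = 0 := by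
  decide


/-- S1 · REGULAR CORE SUPPLY AT 2 (on U1's habitat and frame, verbatim binders + the ring-class-field
instance binder, discharged by `JET.numberField_ringClassField`): there is a depth `r` such that for every
level `M ≥ 1` and bound `b` some conductor `n` with exactly `r` prime factors, all of them regular Kolyvagin
primes `> b` of Kolyvagin index `≥ M` (so `M ≤ M(n)`), carries a Kolyvagin–Heegner datum of the frame and
is a sign-free NEAR-core vertex at level `2^M` with a UNIFORM error exponent `κ` (room for the regular-invisible phantom). Mazur–Rubin Cor. 2.7.3 ("there are core vertices n with
ω(n) = r", r = dim of the residual Selmer group off the core line) at p = 2, the Čebotarev choices made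
REGULAR by the in-tree engine `exists_regular_kolyvaginPrime_of_heegner` (exact local orders prescribed
for finitely many classes ⇒ each added regular prime cuts the non-core part by a free rank-one quotient).
Why it might fail: the engine prescribes local ORDERS of classes, MR's core-vertex induction needs the
localisation to be SURJECTIVE onto `H¹_f(K_λ, E[2^M]) ≅ E[2^M]/(h−1) ≅ ℤ/2^M` for a chosen class and zero
for the others — at 2 the phantom class in `H¹(K(E[2^M])/K, E[2^M]) ≅ ℤ/2` (Lawson–Wuthrich) may block
exactly one bit, leaving index-2 "near-cores" only. -/
def RegularCoreSupplyAtTwo : Prop :=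
  ∀ (W : WeierstrassCurve ℚ) [W.IsElliptic] [W.IsGloballyMinimal], ¬ W.HasCM → (Literature.NumberTheory.EllipticCurves.Rank1Residual.GoodOrd W 2 ∨ Literature.NumberTheory.EllipticCurves.Rank1Residual.Mult W 2) → (∀ m : ℕ, W.HasSurjectiveModNGaloisRep (2 ^ m : ℕ)) → ∀ (K : Type) [Field K] [NumberField K], Literature.NumberTheory.EllipticCurves.IsImaginaryQuadratic K → ∀ [NeZero (W.conductorNorm ℤ)], Literature.NumberTheory.EllipticCurves.SatisfiesHeegnerHypothesis (W.conductorNorm ℤ) K → Odd (NumberField.discr K) → NumberField.discr K ≠ -3 → AddSubgroup.torsionBy (W.baseChange K).toAffine.Point (2 : ℤ) = ⊥ → Literature.NumberTheory.EllipticCurves.SatisfiesHeegnerHypothesis 2 K → ∀ (Dt : Literature.NumberTheory.EllipticCurves.ModularForms.ModularParametrizationData W (W.conductorNorm ℤ)) (β : ℤ) (ι : K →+* ℂ) [∀ k : ℕ, NumberField (ringClassField K ι k)], (4 * (W.conductorNorm ℤ : ℤ)) ∣ β ^ 2 - NumberField.discr K →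
    ∃ r κ : ℕ, ∀ (M b : ℕ), 1 ≤ M →
      ∃ n : ℕ, Nonempty (Literature.NumberTheory.EllipticCurves.KolyvaginHeegnerData Dt β ι n) ∧
        Literature.NumberTheory.EllipticCurves.KolyvaginDescent.KolSupp (Literature.NumberTheory.EllipticCurves.Zhang2014.IsKolyvaginPrime (W.conductorNorm ℤ) W K 2) n ∧
        n.primeFactors.card = r ∧
        (∀ ℓ ∈ n.primeFactors, b < ℓ ∧ M ≤ Literature.NumberTheory.EllipticCurves.Zhang2014.kolyvaginIndex W 2 ℓ ∧ (∃ (v : HeightOneSpectrum (𝓞 ℚ)) (𝔓 : Ideal (absIntegers (𝓞 ℚ) ℚ)) (h : absoluteGaloisGroup ℚ), (ℓ : 𝓞 ℚ) ∈ v.asIdeal ∧ 𝔓 ∈ v.primesAbove ∧ IsArithFrobAt (𝓞 ℚ) h 𝔓 ∧ (∀ X : geomTorsion W ((2 ^ M : ℕ) : ℤ), h • h • X = X) ∧ ∃ P : geomTorsion W ((2 ^ M : ℕ) : ℤ), (2 : ℤ) ^ (M - 1) • (P + h • P) ≠ 0)) ∧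
        (∃ x ∈ Jetchev2008.modifiedSelmerGroup W K ι ((2 ^ M : ℕ) : ℤ) n, addOrderOf x = 2 ^ M ∧ ∀ y ∈ Jetchev2008.modifiedSelmerGroup W K ι ((2 ^ M : ℕ) : ℤ) n, ∃ t : ℤ, (2 ^ κ : ℤ) • y = t • x)

/-- S1b · SIGN-FREE NEAR-CORE EXISTENCE AT 2 — the load-bearing half of S1, ISOLATED (v3) after the ONE READER's report
(`Cruxes/KolyvaginBoundedDefectAtTwo/S1-READER-g12.md`, seat krr2-p2 g12, 2026-08-28T21:18Z; its recommendation (3)): on U1's habitat and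
frame there are a depth `r` and an error exponent `κ` such that for every level `M ≥ 1` and bound `b` some SQUARE-FREE conductor `n` with
exactly `r` prime factors — all Zhang–Kolyvagin primes at `2`, `> b`, of Kolyvagin index `≥ M` and REGULAR at level `2^M` (the
regularity predicate spelled out: an arithmetic Frobenius `h` over `ℓ` with `h² = 1` on `E[2^M]` and `2^(M−1)(P + hP) ≠ 0` for some `P`)
— is a sign-free near-core vertex of error `κ` (spelled out: a class `x` of exact order `2^M` in the tree's parameter-free
`Jetchev2008.modifiedSelmerGroup W K ι 2^M n` with `2^κ · H ⊆ ℤx`).  The SUPPLY half of S1 (regular Kolyvagin conductors of every depth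
carrying a Kolyvagin–Heegner datum) is the tree theorem `KolyvaginAtTwo.RegularCoreSupply.exists_regularKolyvaginConductor`, and
S1 ⇐ S1b is `KolyvaginAtTwo.RegularCoreSupply.regularCoreSupply_of_nearCoreSupply` (both krr2-p2 g12, p668568, sorry-free) — used
below, so S1 is no longer a stub.  Predicates are INLINED (no local `def`) so that a `Theorems/` proof can state this stub byte-identically
without importing a sorried file.  Why it might fail (the reader's finding (2)(b)–(c)): at a regular `λ` the local condition
`H¹_f(K_λ, E[2^M]) = E[2^M]` is free of rank ONE over `ℤ/2^M[Gal(K/ℚ)]` but of rank TWO over `ℤ/2^M`; `±`-classes cut the modified Selmer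
group by index at most `2^(2M−1)` per prime and a pure-sign Selmer group only by `2^M`, leaving a transverse REFILL `ℤ/2^a`, `a ∈ [1, M]`,
NOT determined by local duality + the Poonen–Rains form — so near-core existence needs a 2-adic REFILL LAW at regular primes
(`a ≥ M − O(1)`), the same missing lemma S2 needs; MR04 Cor. 2.7.3 / Jetchev L.5.2(iii) / Howard are `p` odd.  Deciding instrument (reader):
REG-REFILL at `M = 2` (refill exponent of `H_{𝓕(ℓ)}(K, E[4])` on pure-sign rank-3 frames at regular Kolyvagin `ℓ` of index `≥ 2`;
Magma-class row, not run).  [cite: MazurRubin2004, Cor. 2.7.3, Def. 2.5.3] [cite: Howard2004, Thm. 2.6.1] [cite: Jetchev2008, §5.2] -/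
def NearCoreExistenceAtTwo : Prop :=
  ∀ (W : WeierstrassCurve ℚ) [W.IsElliptic] [W.IsGloballyMinimal], ¬ W.HasCM → (Literature.NumberTheory.EllipticCurves.Rank1Residual.GoodOrd W 2 ∨ Literature.NumberTheory.EllipticCurves.Rank1Residual.Mult W 2) → (∀ m : ℕ, W.HasSurjectiveModNGaloisRep (2 ^ m : ℕ)) → ∀ (K : Type) [Field K] [NumberField K], Literature.NumberTheory.EllipticCurves.IsImaginaryQuadratic K → ∀ [NeZero (W.conductorNorm ℤ)], Literature.NumberTheory.EllipticCurves.SatisfiesHeegnerHypothesis (W.conductorNorm ℤ) K → Odd (NumberField.discr K) → NumberField.discr K ≠ -3 → AddSubgroup.torsionBy (W.baseChange K).toAffine.Point (2 : ℤ) = ⊥ → Literature.NumberTheory.EllipticCurves.SatisfiesHeegnerHypothesis 2 K → ∀ (Dt : Literature.NumberTheory.EllipticCurves.ModularForms.ModularParametrizationData W (W.conductorNorm ℤ)) (β : ℤ) (ι : K →+* ℂ) [∀ k : ℕ, NumberField (ringClassField K ι k)], (4 * (W.conductorNorm ℤ : ℤ)) ∣ β ^ 2 - NumberField.discr K →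
    ∃ r κ : ℕ, ∀ (M b : ℕ), 1 ≤ M →
      ∃ n : ℕ, Squarefree n ∧ n.primeFactors.card = r ∧
        (∀ ℓ ∈ n.primeFactors, Literature.NumberTheory.EllipticCurves.Zhang2014.IsKolyvaginPrime (W.conductorNorm ℤ) W K 2 ℓ ∧ b < ℓ ∧
          M ≤ Literature.NumberTheory.EllipticCurves.Zhang2014.kolyvaginIndex W 2 ℓ ∧ (∃ (v : HeightOneSpectrum (𝓞 ℚ)) (𝔓 : Ideal (absIntegers (𝓞 ℚ) ℚ)) (h : absoluteGaloisGroup ℚ), (ℓ : 𝓞 ℚ) ∈ v.asIdeal ∧ 𝔓 ∈ v.primesAbove ∧ IsArithFrobAt (𝓞 ℚ) h 𝔓 ∧ (∀ X : geomTorsion W ((2 ^ M : ℕ) : ℤ), h • h • X = X) ∧ ∃ P : geomTorsion W ((2 ^ M : ℕ) : ℤ), (2 : ℤ) ^ (M - 1) • (P + h • P) ≠ 0)) ∧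
        (∃ x ∈ Jetchev2008.modifiedSelmerGroup W K ι ((2 ^ M : ℕ) : ℤ) n, addOrderOf x = 2 ^ M ∧ ∀ y ∈ Jetchev2008.modifiedSelmerGroup W K ι ((2 ^ M : ℕ) : ℤ) n, ∃ t : ℤ, (2 ^ κ : ℤ) • y = t • x)

/-- **S1 ⇐ S1b** (v3; bookkeeping by krr2-p2's landed generic reduction with `Reg` := regularity and `Core` := near-core, inlined;
the Kolyvagin–Heegner datum from Gross §3 CM, proved in tree).  No sorry. -/
theorem regularCoreSupplyAtTwo_of_nearCore (h : NearCoreExistenceAtTwo) : RegularCoreSupplyAtTwo := by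
  intro W _ _ hCM hred hsurj K _ _ hK _ hH hodd hd3 htors hH2 Dt β ι _ hβ
  exact Summit.BirchSwinnertonDyer.BirchSwinnertonDyer.Theorems.KolyvaginAtTwo.RegularCoreSupply.regularCoreSupply_of_nearCoreSupply
    hK hH Dt β ι hβ (h W hCM hred hsurj K hK hH hodd hd3 htors hH2 Dt β ι hβ)

/-- S2 · CORE RIGIDITY AT 2 (THE HARDEST STUB; beyond print). On U1's habitat and frame: a SEED — one
non-zero Kolyvagin class `c_{M₁}(n₁) ≠ 0` at some Kolyvagin conductor and level `1 ≤ M₁ ≤ M(n₁)` (the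
conclusion of `KolyvaginNonvanishingAtTwoFrame`, verbatim) — forces, for each error exponent `κ`, ONE global defect `a : ℕ` such that at
EVERY sign-free near-core vertex (error `κ`) `(n, M)` supported on regular Kolyvagin primes of index `≥ M`, and every level
`M > a`, every Kolyvagin–Heegner datum `d` of conductor `n` has `2^(M−a−1) · c_M(n) ≠ 0` (order ≥ 2^{M−a}).
Mazur–Rubin Cor. 2.8.9 (2) / Thm. 3.2.3 (KS free of rank one over ℤ₂, generated by a primitive `κ^prim`,
`κ^Heeg = 2^a κ^prim`, `a < ∞` iff `κ^Heeg ≠ 0` ⟸ seed) + Thm. 2.8.5 / Howard Thm. 2.8.8 (at a core vertex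
`KS → H_{𝓕(n)} ≅ ℤ/2^M` is an isomorphism, so `κ^prim_n` generates and `ord κ^Heeg_n = 2^{M−a}`), run at
p = 2 with (H.2) := REGULARITY of the primes (`E[2^M]/(h−1) ≅ ℤ/2^M`) and (H.4) replaced by the engine's
simultaneous Frobenius prescription. Why it might fail: (H.3) fails at 2 — the phantom
`H¹(ℚ(E[2^M])/ℚ, E[2^M]) ≅ ℤ/2` (Lawson–Wuthrich 2016) may make `KS(E[2^M])` free of rank one only up to
a 2-torsion error that is NOT uniform in `M`, or Howard's surjectivity `Γ(H₀) ↠ H₀(n)` may lose one bit per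
prime (then `a` would grow with the depth `r` — still fine for U1 at fixed `r` — or with `M` — fatal).
Honours the Disproof-side facts on the sibling cruxes: it USES the seed (no seed ⇒ no bound: `a = ∞`), and it
restricts to CORE vertices (at non-core `n` the class order is eaten by `M_n`, defect unbounded — the
recorded reason "uniform defect over all n" is false). -/
def CoreRigidityAtTwo : Prop :=
  ∀ (W : WeierstrassCurve ℚ) [W.IsElliptic] [W.IsGloballyMinimal], ¬ W.HasCM → (Literature.NumberTheory.EllipticCurves.Rank1Residual.GoodOrd W 2 ∨ Literature.NumberTheory.EllipticCurves.Rank1Residual.Mult W 2) → (∀ m : ℕ, W.HasSurjectiveModNGaloisRep (2 ^ m : ℕ)) → ∀ (K : Type) [Field K] [NumberField K], Literature.NumberTheory.EllipticCurves.IsImaginaryQuadratic K → ∀ [NeZero (W.conductorNorm ℤ)], Literature.NumberTheory.EllipticCurves.SatisfiesHeegnerHypothesis (W.conductorNorm ℤ) K → Odd (NumberField.discr K) → NumberField.discr K ≠ -3 → AddSubgroup.torsionBy (W.baseChange K).toAffine.Point (2 : ℤ) = ⊥ → Literature.NumberTheory.EllipticCurves.SatisfiesHeegnerHypothesis 2 K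 → ∀ (Dt : Literature.NumberTheory.EllipticCurves.ModularForms.ModularParametrizationData W (W.conductorNorm ℤ)) (β : ℤ) (ι : K →+* ℂ) [∀ k : ℕ, NumberField (ringClassField K ι k)], (4 * (W.conductorNorm ℤ : ℤ)) ∣ β ^ 2 - NumberField.discr K → ∀ κ : ℕ,
    (∃ (n₁ : ℕ) (d₁ : Literature.NumberTheory.EllipticCurves.KolyvaginHeegnerData Dt β ι n₁) (M₁ : ℕ),
        Literature.NumberTheory.EllipticCurves.KolyvaginDescent.KolSupp (Literature.NumberTheory.EllipticCurves.Zhang2014.IsKolyvaginPrime (W.conductorNorm ℤ) W K 2) n₁ ∧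
        1 ≤ M₁ ∧ (M₁ : ℕ∞) ≤ Literature.NumberTheory.EllipticCurves.Zhang2014.levelIndex W 2 n₁ ∧ d₁.kolyvaginClass Nat.prime_two M₁ ≠ 0) →
    ∃ a : ℕ, ∀ (M n : ℕ) (d : Literature.NumberTheory.EllipticCurves.KolyvaginHeegnerData Dt β ι n),
      Literature.NumberTheory.EllipticCurves.KolyvaginDescent.KolSupp (Literature.NumberTheory.EllipticCurves.Zhang2014.IsKolyvaginPrime (W.conductorNorm ℤ) W K 2) n →
      (∀ ℓ ∈ n.primeFactors, M ≤ Literature.NumberTheory.EllipticCurves.Zhang2014.kolyvaginIndex W 2 ℓ ∧ (∃ (v : HeightOneSpectrum (𝓞 ℚ)) (𝔓 : Ideal (absIntegers (𝓞 ℚ) ℚ)) (h : absoluteGaloisGroup ℚ), (ℓ : 𝓞 ℚ) ∈ v.asIdeal ∧ 𝔓 ∈ v.primesAbove ∧ IsArithFrobAt (𝓞 ℚ) h 𝔓 ∧ (∀ X : geomTorsion W ((2 ^ M : ℕ) : ℤ), h • h • X = X) ∧ ∃ P : geomTorsion W ((2 ^ M : ℕ) : ℤ), (2 : ℤ) ^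 (M - 1) • (P + h • P) ≠ 0)) →
      (∃ x ∈ Jetchev2008.modifiedSelmerGroup W K ι ((2 ^ M : ℕ) : ℤ) n, addOrderOf x = 2 ^ M ∧ ∀ y ∈ Jetchev2008.modifiedSelmerGroup W K ι ((2 ^ M : ℕ) : ℤ) n, ∃ t : ℤ, (2 ^ κ : ℤ) • y = t • x) → a < M →
      (2 ^ (M - a - 1) : ℤ) • d.kolyvaginClass Nat.prime_two M ≠ 0

/-- S0 (BY NAME): the seed — Kolyvagin's conjecture at 2 in frame form, V1′ of the route
(`KolyvaginNonvanishingAtTwoFrame`; equivalent to the asided item V1′ `KolyvaginNonvanishingAtTwo` by the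
turnkey's `nonvanishingFrame_of`). Beyond print (W. Zhang 2014 / BCGS need p odd); it is the INPUT of the line. -/
theorem stub_seedNonvanishingAtTwo : KolyvaginNonvanishingAtTwoFrame := by
  sorry

/-- N3″ · START FRAME AT 2 (v5 DRAFT by the ONE READER krr2-p2 g15; replaces the S1b stub, which is now DERIVED).
On U1's habitat and for the non-trivial `τ ∈ Gal(K/ℚ)`: an ODD number `m` of `τ_*`-eigenclasses of every level `2^k` in
`Sel_{2^k}(E/K) = H_{𝓕(1)}` with a level-independent sign pattern `sg`, one of them (`g i₀`) of exact order `2^k`, generating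
`Sel_{2^k}` up to `2^J` and the inflation kernel `ker res_{k+1}` (F3) and independent modulo `2^(k−d)` and that kernel (F4);
`m, sg, J, d` independent of `k`.  VERBATIM the hypothesis of the tree theorem
`KolyvaginAtTwo.RegularWalk.nearCoreExistenceAtTwo_of_startFrame` (p<WalkNearCore>).  PROOF PLAN (support-sized, print +
dictionary): `D = div Sel_{2^∞}(E/K) ≅ (ℚ₂/ℤ₂)^{r_∞}`, `D = (1+τ)D + (1−τ)D` (coranks `a' + b' = r_∞`, `D⁺ ∩ D⁻ ⊆ D[2]`), bases of
`D^±[2^k]` transported through `Sel_{2^k} ≅ Sel_{2^∞}[2^k]` (`E(K)[2] = 0`); `J = 1 + log₂ #(Sel_{2^∞}/D)`, `d = 2` (Sah at 2);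
`m = r_∞` ODD is 2-PARITY over `K` (Kramer 1981 Thm 1 / Monsky 1996 L.1.4(b), the tree's named fact
`Monsky1996_lemma14b_twoSelmerRank_parity`).  Why it might fail: only mis-typing; the parity input is NECESSARY (reader g14 §2).
[cite: Kramer1981, Thm. 1] [cite: Monsky1996, Lemma 1.4(b)] [cite: Greenberg1999, §1–2] -/
def StartFrameAtTwo : Prop :=
  ∀ (W : WeierstrassCurve ℚ) [W.IsElliptic] [W.IsGloballyMinimal], ¬ W.HasCM → (Literature.NumberTheory.EllipticCurves.Rank1Residual.GoodOrd W 2 ∨ Literature.NumberTheory.EllipticCurves.Rank1Residual.Mult W 2) → (∀ m : ℕ, W.HasSurjectiveModNGaloisRep (2 ^ m : ℕ)) → ∀ (K : Type) [Field K] [NumberField K], Literature.NumberTheory.EllipticCurves.IsImaginaryQuadratic K → ∀ [NeZero (W.conductorNorm ℤ)], Literature.NumberTheory.EllipticCurves.SatisfiesHeegnerHypothesis (W.conductorNorm ℤ) K → Odd (NumberField.discr K) → NumberField.discr K ≠ -3 → AddSubgroup.torsionBy (W.baseChange K).toAffine.Point (2 : ℤ) = ⊥ → Literature.NumberTheory.EllipticCurves.SatisfiesHeegnerHypothesis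 2 K → ∀ (Dt : Literature.NumberTheory.EllipticCurves.ModularForms.ModularParametrizationData W (W.conductorNorm ℤ)) (β : ℤ) (ι : K →+* ℂ) [∀ k : ℕ, NumberField (ringClassField K ι k)], (4 * (W.conductorNorm ℤ : ℤ)) ∣ β ^ 2 - NumberField.discr K → ∀ (τ : K ≃ₐ[ℚ] K), τ ≠ 1 →
        ∃ (m : ℕ) (sg : Fin m → ℤ) (i₀ : Fin m) (J d : ℕ), Odd m ∧ (∀ i, sg i = 1 ∨ sg i = -1) ∧
          ∀ k : ℕ, 1 ≤ k → ∃ g : Fin m → galH1Torsion (W.baseChange K) ((2 ^ k : ℕ) : ℤ),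
            (∀ i, g i ∈ Jetchev2008.modifiedSelmerGroup W K ι ((2 ^ k : ℕ) : ℤ) 1) ∧
            (∀ i, conjAct W τ ((2 ^ k : ℕ) : ℤ) (g i) = sg i • g i) ∧ addOrderOf (g i₀) = 2 ^ k ∧
            (∀ u : galH1Torsion (W.baseChange K) ((2 ^ k : ℕ) : ℤ),
              u ∈ Jetchev2008.modifiedSelmerGroup W K ι ((2 ^ k : ℕ) : ℤ) 1 → ∃ b : Fin m → ℤ,
                ∀ ρ ∈ torsionFixing (W.baseChange K) ((2 ^ (k + 1) : ℕ) : ℤ),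
                  h1Eval (W.baseChange K) ((2 ^ k : ℕ) : ℤ) (((2 : ℤ) ^ J) • u - ∑ i, b i • g i) ρ = 0) ∧
            (∀ b : Fin m → ℤ, (∀ ρ ∈ torsionFixing (W.baseChange K) ((2 ^ (k + 1) : ℕ) : ℤ),
                h1Eval (W.baseChange K) ((2 ^ k : ℕ) : ℤ) (∑ i, b i • g i) ρ = 0) → ∀ i, (2 : ℤ) ^ (k - d) ∣ b i)

/-- N3″ stub (v5 draft): the start frame. -/
theorem stub_startFrameAtTwo : StartFrameAtTwo := by
  sorry

/-- S1b (no longer a stub in v5): DERIVED from the start frame by the ONE READER's kernel theorem (the regular-prime WALK,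
`Theorems/KolyvaginRankRigidityAtTwoWalk*.lean`). -/
theorem stub_nearCoreExistenceAtTwo : NearCoreExistenceAtTwo :=
  Summit.BirchSwinnertonDyer.BirchSwinnertonDyer.Theorems.KolyvaginAtTwo.RegularWalk.nearCoreExistenceAtTwo_of_startFrame
    stub_startFrameAtTwo

/-- S1 (no longer a stub in v3): from S1b by the landed reduction. -/
theorem regularCoreSupplyAtTwo_of_stub : RegularCoreSupplyAtTwo :=
  regularCoreSupplyAtTwo_of_nearCore stub_nearCoreExistenceAtTwo

/-- S2 (hardest): core rigidity at 2 — one global defect at all regular core vertices (MR Cor. 2.8.9 (2),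
Thm. 3.2.3, Howard Thm. 2.8.8 at p = 2 with (H.2) := regularity). -/
theorem stub_coreRigidityAtTwo : CoreRigidityAtTwo := by
  sorry

/-- COMPOSITION (kernel-checked, no sorry of its own): S0 → S1 → S2 → U1, with `r` := the depth of S1 and
`m := a` the global defect of S2; the level clause `M ≤ M(n)` from the indices of the regular primes
(`Zhang2014.natCast_le_levelIndex_iff`), the ring-class-field instance from `JET.numberField_ringClassField`. -/
theorem KolyvaginBoundedDefectAtTwo_of (h0 : KolyvaginNonvanishingAtTwoFrame)
    (h1 : RegularCoreSupplyAtTwo) (h2 : CoreRigidityAtTwo) : KolyvaginBoundedDefectAtTwo := by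
  intro W _ _ hCM hred hsurj K _ _ hK _ hH hodd hd3 htors hH2 Dt β ι hβ
  haveI : ∀ k : ℕ, NumberField (ringClassField K ι k) :=
    Summit.BirchSwinnertonDyer.Rank1Residual.JET.numberField_ringClassField K hK ι
  have hseed := h0 W hCM hred hsurj K hK hH hodd hd3 htors hH2 Dt β ι hβ
  obtain ⟨r, κ, hr⟩ := h1 W hCM hred hsurj K hK hH hodd hd3 htors hH2 Dt β ι hβ
  obtain ⟨a, ha⟩ := h2 W hCM hred hsurj K hK hH hodd hd3 htors hH2 Dt β ι hβ κ hseed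
  refine ⟨r, a, fun M hM ↦ ?_⟩
  obtain ⟨n, ⟨d⟩, hKol, hcard, hreg, hcore⟩ := hr M 0 (by omega)
  refine ⟨n, d, hKol, hcard, ?_, ha M n d hKol (fun ℓ hℓ ↦ ⟨(hreg ℓ hℓ).2.1, (hreg ℓ hℓ).2.2⟩) hcore hM⟩
  exact Zhang2014.natCast_le_levelIndex_iff.mpr fun ℓ hℓ ↦ (hreg ℓ hℓ).2.1

/-- The composition concludes the crux BY NAME (audit anchor). -/
theorem KolyvaginBoundedDefectAtTwo_of_stubs : KolyvaginBoundedDefectAtTwo :=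
  KolyvaginBoundedDefectAtTwo_of stub_seedNonvanishingAtTwo regularCoreSupplyAtTwo_of_stub stub_coreRigidityAtTwo

end Summit.BirchSwinnertonDyer.BirchSwinnertonDyer.Cruxes.KolyvaginBoundedDefectAtTwo.RegularCoreRigidity

end
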